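import Summits.Ventures.HSemireg.Pad4TowerPsiSubA1

/-!
# Monad ∕ presentation vocabulary, generic in the ALPHABET — blocks B ∕ A of the forest move (hsemireg-typer-3 g0, STAGING, 2026-08-29)

Crux of record `Summit.HodgeConjecture.HodgeConjecture.Theses.EightfoldBlochSeeds.BlochSeedDiscOne` (item stmt-HodgeConjecture-18881;
line token `Lines/birth.lean` 814a6a70c14e831a `stub_rung_pad4_seedAt` — positive side: ONE (A1)-clean design with `μ ≠ 0` realised by a
vector bundle = a SEED).  Brief: director-hodge g20 R19.171 (req-80 row B5) + R19.177 «B5 typer-3 — draft `MonadDesign` ∕ `Presentation`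
structures over the tree's `LineCell`∕letter vocabulary (M1∕M2) as a STAGING file, generic in the alphabet (a typeclass-free record of letters +
ch map + maps datum); type the first PASSed spec into it».

HONEST FRAMING.  This file is VOCABULARY: definitions with bodies and small sanity theorems (bookkeeping identities, `decide` probes).  It types
the objects the cell's seed-condition table talks about (card `birth-v4.md` v4.35 rows W36∕W37; R19.149∕157∕162∕164∕168): presentations
`⊕P → ⊕N → 𝓔 → 0` ∕ `0 → 𝓔 → ⊕N → ⊕P` and three-term monads `⊕_A →ⁱ ⊕_N →^q ⊕_C`, `𝓔 = ker q ∕ im i`, class `N − A − C`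
(C3ᴹ, monad-1 `B1SHARP-KILL` f6b5677c §0–§3, crit-hsem-2 memo-02 A.2), the (H1) = (A1) class screen ∕ rank ∕ μ functionals on them, the Σ = ∅
Hall conditions KI ∕ KQ ∕ KJ (shared `N`-capacity) and their flow certificates, over ANY alphabet given as a record
`(Letter, phi : Letter → letter vector in the frame (1,u,v,e,ē,p), Live : Hom ≠ 0 relation, hom : its dimension model)`; and three alphabets:
the integer balanced alphabet 𝔅(μ₄) of record (`BPoint`, `bphi`, live = `Effective`; cells = `MCell`, so every tree theorem about
`ClassScreen (C.wch mN mP)` applies verbatim — `Presentation.wch_ofMConfig`), the BOX semi-homogeneous alphabet (semihom-1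
`SEMIHOM-ALPHABET-LINE14` f4334e64 §A–§D: rational slopes `num ∕ den` with rank weight `rk`, `ch = rk·e^{δ}`, written at a common SCALE `L` by
the denominator-clearing reduction ×2 control∕R19.162 — here the kernel lemma `classScreen_degScale_iff`), and isogeny-pushforward letters
(alphabet-isogeny-1's object, typed as data ↦ box letters).  `SubLineCell h` ∕ `BandCell h w` (every letter an axis letter of top `≤ h`, resp. in
`[h − w, h]`; BAND-4@12 support M = `BandCell 12 4`) strictly contain `LineCell h` (M1 vocabulary of `LinePhaseTorus` 7bccd058, mirrored in §0
until `Pad4TowerLineLetters` is in the tree); box cells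
(`(boxAlphabet L).Cell`) strictly contain the integer cells (`SemihomLetter.ofPt`, rank weight 1).
NOTHING here is a monad, a SOURCE or a SEED; Hall ∕ flow conditions are NECESSARY generic-rank bookkeeping, not existence of maps; the W₁-kill
tests (B1♯), d² = 0 (B1), Pic⁰ labellings and everything geometric stay pencil ∕ kit.  Nothing is proved toward HC ∕ HC_CM ∕ HC_AV ∕ №4 ∕ 26512 ∕
18881 ∕ H2.  No `instance`, no `notation`, no named fact, 0 `sorry`; census-neutral.

CONTENT.
* §0 M1 mirror (`lineLetter`, `LineCell`, `betaG`, `bphi_zero`, `ch_eq_prod`, `ch_eWord` — verbatim; temporary).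
* §1 `Alphabet R` (factorwise record: letters + `phi` + `Live` + `hom`), `Alphabet.Cell = Fin 4 → Letter`, `cellCh` (tensor of the four letter
  vectors, = `chTensor`), `CellLive` (factorwise, Künneth), `cellHom` (product); `Unital` (`phi x 1 = 1`: rank-one letters); **`CellAlphabet R`**
  (cell-level record: cells + class tensor on the word frame + `Live` + `hom` — what designs read; hosts constituents that are NOT box products,
  e.g. block B1's NON-BOX semi-homogeneous bundles once their frame is fixed) and `Alphabet.toCell` (Künneth).
* §2 `Presentation 𝔠` (two-term: `N`, `P`, `mN`, `mP`) and `MonadDesign 𝔠` (three-term: `A`, `N`, `C`, `mA`, `mN`, `mC`) over a CELL alphabet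
  `𝔠`; functionals `wch`
  (class tensor `Σ_N m ch − Σ_A m ch − Σ_C m ch`), `rank` (= `wch 1111`), `count` (copies `Σ m_N − Σ m_A − Σ m_C`; `= rank` on unital
  alphabets), `mu = wch eeee`, `muBar`, `Clean = ClassScreen wch` ((H1) of record), `Pos`∕`Nonneg`, `IsTwoTerm`; the embeddings
  `ofCokernel` (UP: `A = P`, `C = ∅`) ∕ `ofKernel` (DOWN: `A = ∅`, `C = P`) with `wch` unchanged; `addN`∕`addA` and **`wch_addA_addN`**
  (PAIR PADDING IS CLASS-NEUTRAL: the identity-pair padding of crit memo-02 A.1 (ii) ∕ g29 §C for any cell and alphabet);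
  `MonadDesign.ofLists` ∕ `Presentation.ofLists` (designs from association lists `(cell, m)` — the target of the JSON converter
  `hsemireg-typer-3∕tools∕design2lean.py`: ac808a66 ↦ 3 538 cells, elaborates in ≈ 80 s).
* §3 Hall: `HallI` (A into N along i-live pairs), `HallQ` (C from N along q-live pairs), `HallJ` (joint, shared N-capacity = crit memo-02 A.2's
  combined-graph condition), written WITHOUT neighbourhood filters (`∀ W ⊇ Γ(U)`) over `powerset`s — DECIDABLE on concrete designs
  (`decide` probes); `HallJ → HallI ∧ HallQ`; `JointFlow` (the certificate a kit LP returns) and weak duality `hallJ_of_jointFlow`;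
  `count_nonneg_of_hallJ`; `Presentation.HallUp`∕`HallDown`.
* §4 the integer letters `bLetters` (𝔅(μ₄): `phi = bphi`, `Live x y = Effective (y − x)`, `hom = homB` = the Hom-dimension MODEL of record
  B0 (G1) ∕ memo-88 (iii) ∕ Riemann–Roch) and the cell alphabet `bAlph = bLetters.toCell` (cells = `MCell`, `ch = MCell.ch`, `Live = MCell.le`),
  `Presentation.ofMConfig` ∕ `wch_ofMConfig`,
  `mu_eq_sum_prod_betaG` (μ = Σ ν Π_f β_f), `SubLineCell`, `BandCell` (laws) and the universes OF RECORD `LineCellStd` (`2c ≤ h`) ∕ `BandCellStd`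
  (even tops, `2c ≤ t`; `bandLetters 12 4` has 63 letters, `bandLetters 14 0` has 29 — `bandLetters_card`), `apexCell` with the hub-liveness facts of
  memo-02 A.1 (i) (`le_apexCell`, `eq_apexCell_of_le`), `apex_clean` (the identity summand is clean with μ = 0).
* §5 `bscale`, `degScale`, `bphi_bscale`, `ch_bscale`, **`classScreen_degScale_iff`** (clearing denominators preserves (A1) both ways);
  `SemihomLetter` (`num`, `den`, `rk`), `atScale`, `boxLetters L` ∕ `boxAlphabet L = (boxLetters L).toCell`, `BoxCell`, `ofPt` (integer letters =
  rank-one box letters, class preserved),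
  `onLine` (semihom-1 (A.1) line letters `c = C∕l`, rank weight `l`), strictness witnesses; `GPoint`∕`uphi` (unbalanced letters `(α, α′, β)`,
  pad4lib `phi(blk(α, α′, β))`, `gLetters` ∕ `gAlph`), `IsogenyLetter ↦ SemihomLetter`.
* §5b UNIPOTENT letters (block B2, alphabet-unipotent-1 SPEC §1–§2; R19.217 (3) ×1): `UnipLetter {pt, m}`, `unipLetters` (`phi = m • bphi`),
  `unipAlphabet`, **`cellCh_unip`** (LEMMA CH in kernel form: `ch = (Π m_f)·ch(L_Z)` — class-neutral), `live_unip_iff`.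
* §7 (placed before §6) the COMPOUND frame of `E⁸` and the NON-BOX alphabet (block B1, semihom-2 SPEC-NONBOX v1.4 §A–§D, word «OPEN — LIVE ×1»):
  `XWord = Finset (Fin 8) × Finset (Fin 8)`, `I0`, `J0`, `minor M I J = det M[I;J]`, `compoundCh r M` (`ch_k ↔ r·∧^k M`), **`XScreen`** ((A1) on the
  compound frame: off-diagonal entries vanish except the Weil words `(I₀;J₀)`, `(J₀;I₀)`; equal-size diagonal entries agree), `PrincipalMinorsNonneg`
  (psd live rule), `NonboxLetter {M, rk}` (`IsHerm`, `IsBox`), `boxMatrix`/`NonboxLetter.ofMCell` (the §B dictionary as a definition), **`nonboxAlphabet :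
  CellAlphabet GaussianInt XWord`**, and the read-out `MonadDesign.rankX` ∕ `muX` (the WEIL MINOR) ∕ `muBarX` ∕ `CleanX`; KERNEL PROBES
  (`decide`): `fourier_probe` — semihom-2 §C's Fourier letter `[[2I,F₄],[F₄*,2I]]` is Hermitian, not box, `μ = det F₄ = −16·i` (their
  `run-letters-h4.log` digit); `fcCell_dictionary_probe` — the block matrix of the FC cell has Weil minor `−1 = fcCell.ch eeee` (§B dictionary on
  one cell), `p`-minor `0`, `u`-entry `1`; `live_dictionary_probe` — the psd live rule vs `MCell.le` on a live Koszul step (moved block psd of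
  rank 1) and on a dead step (a negative principal minor refutes psd, `not_principalMinorsNonneg_of_neg`).
* §6 kernel probes (`decide`): the FC cell as a one-cell kernel presentation is not clean (tree `not_classScreen_fcCell` transported); the
  KOSZUL three-term design `λ(1,5) → λ(1,3)² → λ(1,1)` on factor `0` at `h = 14` (B1PRIME §3(d), exact on `E`): genuinely three-term, joint
  Hall holds, class ZERO (`count = 0`, `μ = 0`); a band cell that is no line cell.

SOURCES (sha16 ∕ bus): R19.171 l.5562, R19.177 l.5602; card v4.35 65f7863c4b57e6ad W36∕W37; monad-1 B1SHARP-KILL f6b5677c3ecc9813, T2-CALIBRATION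
3e816608503e7f74; semihom-1 SEMIHOM-ALPHABET-LINE14 f4334e64ee667ee2; crit-hsem-2 memo-02 96d5265ee23f1ebe, memo-05 4646f76b054fdc3a; designs of record
ac808a66 (S′ monad), 08162ddb (colour-blind), bf2edc09 (S131), 1840bf64 (M, BAND-4@12); tree `Pad4TowerLlite` (BPoint, Effective), `Pad4TowerCrossPhase`
(MCell, MConfig, MCell.le), `Pad4TowerClassScreen` (CWord, ClassScreen, chTensor, phiVec, ldeg∕wdeg), `Pad4TowerPsiSubA1` (bphi, MCell.ch, MConfig.wch,
fcCell); crux `LinePhaseTorus.lean` 7bccd0589afd5c59 (lineLetter, LineCell, betaG, ch_eWord, UpFlow∕DownFlow) = tree M1∕M2 `Pad4TowerLineLetters`∕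
`Pad4TowerLineMoments` (4995da7d ∕ 3d09d110, landing train typer-1).
-/

set_option linter.dupNamespace false

namespace Summit.HodgeConjecture.HodgeConjecture.Cruxes.BlochSeedDiscOne.MonadAlphabet

open Finset BigOperators Summit.Ventures.HSemireg Summit.Ventures.HSemireg.Pad4Tower

/-! ## §0 Mirror of the M1 letter vocabulary (`Pad4TowerLineLetters`, typer-1 4995da7d = crux `LinePhaseTorus.lean` 7bccd058 §1∕§1b)
The farm does not serve the crux workfile's olean and M1 is not yet in the tree, so the SIX declarations this file uses are mirrored here with
VERBATIM bodies (same names, this namespace); v2 deletes this section in favour of `import Summits.Ventures.HSemireg.Pad4TowerLineLetters` —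
`LineCell` here ↔ there is then `Iff.rfl`.  Nothing new. -/

/-- [M1 mirror] the LINE-`h` letter of charge `c` and phase `k`: `(α, β) = (h − c, c·conj(i^k))`. -/
def lineLetter (h : ℤ) (c : ℕ) (k : Fin 4) : BPoint :=
  (h - c, (c : ℤ) * ![1, 0, -1, 0] k, (c : ℤ) * ![0, -1, 0, 1] k)

/-- [M1 mirror] a cell all of whose letters lie on the LINE `α + c = h`. -/
def LineCell (h : ℤ) (Z : MCell) : Prop := ∀ f, ∃ c : ℕ, ∃ k : Fin 4, Z f = lineLetter h c k

/-- [M1 mirror] `β_f` as a Gaussian integer. -/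
def betaG (Z : MCell) (f : Fin 4) : GaussianInt := ⟨(Z f).2.1, (Z f).2.2⟩

/-- [M1 mirror] the `1`-slot of a letter vector is `1`. -/
theorem bphi_zero (x : BPoint) : bphi x 0 = 1 := by
  simp [bphi, phiVec]

/-- [M1 mirror] the class tensor of a cell as a product over the factors. -/
theorem ch_eq_prod (Z : MCell) (w : CWord) : Z.ch w = ∏ f, bphi (Z f) (w f) := by
  simp only [MCell.ch, chTensor, Fin.prod_univ_four]

/-- [M1 mirror] the `eeee`-coefficient of a cell's class tensor is `Π_f β_f`. -/
theorem ch_eWord (Z : MCell) : Z.ch eWord = ∏ f, betaG Z f := by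
  simp only [MCell.ch, chTensor, bphi, phiVec, eWord, betaG, Fin.prod_univ_four]
  simp only [Matrix.cons_val]

/-! ## §1 Alphabets: a typeclass-free record of letters + ch map + maps datum -/

/-- **AN ALPHABET** (per factor `S`): a type of LETTERS (constituent bundles on one factor), the CLASS MAP `phi` sending a letter to its
letter vector in the frame `(1, u, v, e, ē, p)` of record (`ch(letter)`; for a line bundle of class `(α, α′, β)` this is
`(1, α, α′, β, β̄, αα′ − |β|²)` = pad4lib `phi`), and the MAPS DATUM: `Live x y` ⟺ «`Hom(x, y) ≠ 0`» (for the matched Pic⁰ twist) and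
`hom x y` = the cell's model of `dim Hom(x, y)`.  A record, not a class: designs carry their alphabet as an explicit argument. -/
structure Alphabet (R : Type) [CommRing R] where
  /-- the letters -/
  Letter : Type
  /-- the class map: letter vector in the frame `0..5 = 1, u, v, e, ē, p` -/
  phi : Letter → Fin 6 → R
  /-- maps datum: `Live x y` = «there is a non-zero map from `x` to `y`» -/
  Live : Letter → Letter → Prop
  /-- maps datum: model of `dim Hom(x, y)` -/
  hom : Letter → Letter → ℕ

variable {R : Type} [CommRing R]

/-- the word `1111` (its coefficient is `ch₀` = the rank). -/
def oneWord : CWord := ![0, 0, 0, 0]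

namespace Alphabet

variable (𝔄 : Alphabet R)

/-- a CELL (constituent) over the alphabet: one letter per factor `f : Fin 4`; geometric reading `⊠_f letter_f` on `S⁴`. -/
abbrev Cell : Type := Fin 4 → 𝔄.Letter

/-- the CLASS TENSOR of a cell: `ch(⊠_f x_f)(w) = Π_f phi(x_f)(w_f)` (Künneth; = `chTensor`). -/
def cellCh (X : 𝔄.Cell) : CWord → R := chTensor fun f => 𝔄.phi (X f)

/-- cells are LIVE (a non-zero map `X → Y` exists) iff they are live on every factor (Künneth). -/
abbrev CellLive (X Y : 𝔄.Cell) : Prop := ∀ f, 𝔄.Live (X f) (Y f)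

/-- the Hom-dimension model of a pair of cells: the product of the factor models (Künneth). -/
def cellHom (X Y : 𝔄.Cell) : ℕ := ∏ f, 𝔄.hom (X f) (Y f)

/-- a UNITAL alphabet: every letter has `ch₀ = 1` (rank-one letters, e.g. line bundles). -/
def Unital : Prop := ∀ x, 𝔄.phi x 0 = 1

theorem cellCh_apply (X : 𝔄.Cell) (w : CWord) :
    𝔄.cellCh X w = 𝔄.phi (X 0) (w 0) * 𝔄.phi (X 1) (w 1) * 𝔄.phi (X 2) (w 2) * 𝔄.phi (X 3) (w 3) := rfl

/-- on a unital alphabet every cell has `ch₀ = 1`. -/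
theorem cellCh_oneWord_of_unital (h𝔄 : 𝔄.Unital) (X : 𝔄.Cell) : 𝔄.cellCh X oneWord = 1 := by
  simp [cellCh_apply, oneWord, h𝔄 (X 0), h𝔄 (X 1), h𝔄 (X 2), h𝔄 (X 3)]

end Alphabet

/-- **A CELL-LEVEL ALPHABET**: constituents (CELLS) given directly with their class tensor on the `6⁴`-word frame, their live relation and Hom
model — what presentations and monad designs actually read.  A factorwise `Alphabet` induces one by Künneth (`Alphabet.toCell`: cells
`Fin 4 → Letter`, `ch = cellCh`, `Live = CellLive`); constituents that are NOT box products of factor letters (block B1's NON-BOX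
semi-homogeneous bundles, §7) are given at this level.  The class FRAME is the word type `W` (`CWord` = the `6⁴`-word frame of the
balanced box lattice; `XWord` = the compound ∕ exterior-algebra frame of `E⁸`, §7). -/
structure CellAlphabet (R : Type) [CommRing R] (W : Type) where
  /-- the cells (constituents) -/
  Cell : Type
  /-- the class tensor of a cell on the word frame `W` -/
  ch : Cell → W → R
  /-- maps datum: `Live X Y` = «there is a non-zero map `X → Y`» -/
  Live : Cell → Cell → Prop
  /-- maps datum: model of `dim Hom(X, Y)` -/
  hom : Cell → Cell → ℕ

/-- a UNITAL cell alphabet: every cell has `ch₀ = 1`. -/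
def CellAlphabet.Unital (𝔠 : CellAlphabet R CWord) : Prop := ∀ X, 𝔠.ch X oneWord = 1

/-- the cell alphabet of a factorwise alphabet (Künneth): cells `Fin 4 → Letter`, `ch = cellCh`, `Live = CellLive`, `hom = cellHom`. -/
abbrev Alphabet.toCell (𝔄 : Alphabet R) : CellAlphabet R CWord := ⟨𝔄.Cell, 𝔄.cellCh, 𝔄.CellLive, 𝔄.cellHom⟩

theorem Alphabet.toCell_unital (𝔄 : Alphabet R) (h𝔄 : 𝔄.Unital) : 𝔄.toCell.Unital := 𝔄.cellCh_oneWord_of_unital h𝔄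

/-! ## §2 Presentations (two-term) and monad designs (three-term); the (H1) ∕ rank ∕ μ functionals -/

/-- **A TWO-TERM PRESENTATION** by cells of the alphabet with integer multiplicities: `N`-cells (sign `+`) and `P`-cells (sign `−`),
class `Σ_N m_N ch(N) − Σ_P m_P ch(P)`.  Read UP as the cokernel presentation `⊕_P → ⊕_N → 𝓔 → 0` or DOWN as the kernel presentation
`0 → 𝓔 → ⊕_N → ⊕_P` (same class; the live pairs differ: `P → N` resp. `N → P`).  Over `bAlph` this is `MConfig` + `(mN, mP)`. -/
structure Presentation {W : Type} (𝔠 : CellAlphabet R W) where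
  /-- the `N`-cells -/
  N : Finset 𝔠.Cell
  /-- the `P`-cells -/
  P : Finset 𝔠.Cell
  /-- multiplicities of the `N`-cells -/
  mN : 𝔠.Cell → ℤ
  /-- multiplicities of the `P`-cells -/
  mP : 𝔠.Cell → ℤ

/-- **A MONAD DESIGN** (three-term): `⊕_{a ∈ A} a^{m_A a} →ⁱ ⊕_{n ∈ N} n^{m_N n} →^q ⊕_{c ∈ C} c^{m_C c}`, `q ∘ i = 0`,
`𝓔 = ker q ∕ im i`; class `N − A − C`; `P = A ⊔ C`, `m_P = m_A + m_C` (W36 C3ᴹ; monad-1 §3 conventions). Letters, ranks and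
multiplicities only — no maps. -/
structure MonadDesign {W : Type} (𝔠 : CellAlphabet R W) where
  /-- the `A`-cells (left term, source of `i`) -/
  A : Finset 𝔠.Cell
  /-- the `N`-cells (middle term) -/
  N : Finset 𝔠.Cell
  /-- the `C`-cells (right term, target of `q`) -/
  C : Finset 𝔠.Cell
  /-- multiplicities of the `A`-cells -/
  mA : 𝔠.Cell → ℤ
  /-- multiplicities of the `N`-cells -/
  mN : 𝔠.Cell → ℤ
  /-- multiplicities of the `C`-cells -/
  mC : 𝔠.Cell → ℤ

namespace Presentation

variable {W : Type} {𝔠 : CellAlphabet R W} (Pr : Presentation 𝔠)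

/-- the weighted class tensor `Σ_N m_N ch(N) − Σ_P m_P ch(P)` of a presentation. -/
def wch : W → R := ∑ Z ∈ Pr.N, Pr.mN Z • 𝔠.ch Z - ∑ Z ∈ Pr.P, Pr.mP Z • 𝔠.ch Z

/-- the copy count `Σ m_N − Σ m_P` (= the rank of `𝓔` on a unital alphabet, generic maps of full term rank). -/
def count : ℤ := ∑ Z ∈ Pr.N, Pr.mN Z - ∑ Z ∈ Pr.P, Pr.mP Z

end Presentation

namespace Presentation

variable {𝔠 : CellAlphabet R CWord} (Pr : Presentation 𝔠)

/-- (H1) of record (box frame): the class tensor passes the class screen (A1) `ch ∈ ℚ[h] ⊕ W`. -/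
def Clean : Prop := ClassScreen Pr.wch

/-- the Weil charge `μ` = the `eeee`-coefficient of the class tensor (box frame). -/
def mu : R := Pr.wch eWord

end Presentation

namespace MonadDesign

variable {W : Type} {𝔠 : CellAlphabet R W} (D : MonadDesign 𝔠)

/-- **the class tensor of the cohomology bundle**: `ch(𝓔) = Σ_N m_N ch(N) − Σ_A m_A ch(A) − Σ_C m_C ch(C)`. -/
def wch : W → R :=
  ∑ Z ∈ D.N, D.mN Z • 𝔠.ch Z - ∑ Z ∈ D.A, D.mA Z • 𝔠.ch Z - ∑ Z ∈ D.C, D.mC Z • 𝔠.ch Z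

/-- the COPY COUNT `Σ m_N − Σ m_A − Σ m_C` (= `rank` on a unital alphabet: `rank_eq_count`). -/
def count : ℤ := ∑ Z ∈ D.N, D.mN Z - ∑ Z ∈ D.A, D.mA Z - ∑ Z ∈ D.C, D.mC Z

/-- positive multiplicities on the three supports (an honest design: every listed cell occurs). -/
abbrev Pos : Prop := (∀ a ∈ D.A, 0 < D.mA a) ∧ (∀ n ∈ D.N, 0 < D.mN n) ∧ ∀ c ∈ D.C, 0 < D.mC c

/-- non-negative multiplicities everywhere. -/
def Nonneg : Prop := (∀ a, 0 ≤ D.mA a) ∧ (∀ n, 0 ≤ D.mN n) ∧ ∀ c, 0 ≤ D.mC c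

/-- a monad design IS a two-term presentation in disguise: one of the outer terms is empty. -/
abbrev IsTwoTerm : Prop := D.A = ∅ ∨ D.C = ∅

/-- `i`-LIVE pair: an `A`-cell `a` and an `N`-cell `n` with a non-zero map `a → n` on every factor. -/
abbrev ILive (a n : 𝔠.Cell) : Prop := a ∈ D.A ∧ n ∈ D.N ∧ 𝔠.Live a n

/-- `q`-LIVE pair: an `N`-cell `n` and a `C`-cell `c` with a non-zero map `n → c` on every factor. -/
abbrev QLive (n c : 𝔠.Cell) : Prop := n ∈ D.N ∧ c ∈ D.C ∧ 𝔠.Live n c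

/-- the UP embedding of a presentation: cokernel presentation `⊕_P →ⁱ ⊕_N → 𝓔 → 0` = the monad with `A = P`, `C = ∅`. -/
def ofCokernel (Pr : Presentation 𝔠) : MonadDesign 𝔠 := ⟨Pr.P, Pr.N, ∅, Pr.mP, Pr.mN, fun _ => 0⟩

/-- the DOWN embedding: kernel presentation `0 → 𝓔 → ⊕_N →^q ⊕_P` = the monad with `A = ∅`, `C = P`. -/
def ofKernel (Pr : Presentation 𝔠) : MonadDesign 𝔠 := ⟨∅, Pr.N, Pr.P, fun _ => 0, Pr.mN, Pr.mP⟩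

theorem wch_ofCokernel (Pr : Presentation 𝔠) : (ofCokernel Pr).wch = Pr.wch := by
  simp [wch, ofCokernel, Presentation.wch]

theorem wch_ofKernel (Pr : Presentation 𝔠) : (ofKernel Pr).wch = Pr.wch := by
  simp [wch, ofKernel, Presentation.wch]

theorem isTwoTerm_ofCokernel (Pr : Presentation 𝔠) : (ofCokernel Pr).IsTwoTerm := Or.inr rfl

theorem isTwoTerm_ofKernel (Pr : Presentation 𝔠) : (ofKernel Pr).IsTwoTerm := Or.inl rfl

theorem count_ofCokernel (Pr : Presentation 𝔠) : (ofCokernel Pr).count = Pr.count := by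
  simp [count, ofCokernel, Presentation.count]

theorem count_ofKernel (Pr : Presentation 𝔠) : (ofKernel Pr).count = Pr.count := by
  simp [count, ofKernel, Presentation.count]

/-- pointwise evaluation of the class tensor. -/
theorem wch_apply (w : W) : D.wch w =
    (∑ Z ∈ D.N, (D.mN Z : R) * 𝔠.ch Z w) - (∑ Z ∈ D.A, (D.mA Z : R) * 𝔠.ch Z w)
      - ∑ Z ∈ D.C, (D.mC Z : R) * 𝔠.ch Z w := by
  simp [wch, Finset.sum_apply, zsmul_eq_mul]

/-- adding `k` copies of a cell to the middle term. -/
def addN [DecidableEq 𝔠.Cell] (Z : 𝔠.Cell) (k : ℤ) : MonadDesign 𝔠 :=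
  ⟨D.A, insert Z D.N, D.C, D.mA, fun X => if X = Z then D.mN X + k else D.mN X, D.mC⟩

/-- adding `k` copies of a cell to the left term. -/
def addA [DecidableEq 𝔠.Cell] (Z : 𝔠.Cell) (k : ℤ) : MonadDesign 𝔠 :=
  ⟨insert Z D.A, D.N, D.C, fun X => if X = Z then D.mA X + k else D.mA X, D.mN, D.mC⟩

/-- bookkeeping: bumping the multiplicity of `Z` by `k` on a term adds `k • ch(Z)` to that term's class sum (whether or not `Z` was listed,
provided unlisted cells carry multiplicity `0`). -/
theorem sum_bump [DecidableEq 𝔠.Cell] (S : Finset 𝔠.Cell) (m : 𝔠.Cell → ℤ) (Z : 𝔠.Cell) (k : ℤ) (h0 : Z ∉ S → m Z = 0) :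
    ∑ X ∈ insert Z S, (if X = Z then m X + k else m X) • 𝔠.ch X = (∑ X ∈ S, m X • 𝔠.ch X) + k • 𝔠.ch Z := by
  by_cases hZ : Z ∈ S
  · rw [Finset.insert_eq_of_mem hZ, ← Finset.add_sum_erase S _ hZ, ← Finset.add_sum_erase S _ hZ, if_pos rfl, add_smul]
    have : ∑ X ∈ S.erase Z, (if X = Z then m X + k else m X) • 𝔠.ch X = ∑ X ∈ S.erase Z, m X • 𝔠.ch X :=
      Finset.sum_congr rfl fun X hX => by rw [if_neg (Finset.ne_of_mem_erase hX)]
    rw [this]; abel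
  · rw [Finset.sum_insert hZ, if_pos rfl, h0 hZ, zero_add]
    have : ∑ X ∈ S, (if X = Z then m X + k else m X) • 𝔠.ch X = ∑ X ∈ S, m X • 𝔠.ch X :=
      Finset.sum_congr rfl fun X hX => by rw [if_neg (by rintro rfl; exact hZ hX)]
    rw [this, add_comm]

/-- **PAIR PADDING IS CLASS-NEUTRAL** (the identity-pair padding of crit memo-02 A.1 (ii) ∕ g29 §C, for ANY cell and alphabet): adding `k`
copies of the same cell `Z` to the middle term AND to the left term leaves `ch(𝓔)` — hence (H1), rank and μ — unchanged. -/
theorem wch_addA_addN [DecidableEq 𝔠.Cell] (Z : 𝔠.Cell) (k : ℤ) (hN : Z ∉ D.N → D.mN Z = 0) (hA : Z ∉ D.A → D.mA Z = 0) :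
    ((D.addN Z k).addA Z k).wch = D.wch := by
  simp only [wch, addA, addN]
  rw [sum_bump D.N D.mN Z k hN, sum_bump D.A D.mA Z k hA]
  abel

/-- the multiplicity a cell receives from an association list `(cell, m)` (sum of all its entries; `0` if absent). -/
def mult [DecidableEq 𝔠.Cell] (l : List (𝔠.Cell × ℤ)) (Z : 𝔠.Cell) : ℤ := (l.map fun p => if p.1 = Z then p.2 else 0).sum

/-- **a monad design from three association lists** `(cell, multiplicity)` — the shape the cell's design JSONs (`split.A`, `N`, `split.C`)
convert to (`hsemireg-typer-3/tools/design2lean.py`). -/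
def ofLists [DecidableEq 𝔠.Cell] (lA lN lC : List (𝔠.Cell × ℤ)) : MonadDesign 𝔠 :=
  ⟨(lA.map Prod.fst).toFinset, (lN.map Prod.fst).toFinset, (lC.map Prod.fst).toFinset, mult lA, mult lN, mult lC⟩

theorem mult_nil [DecidableEq 𝔠.Cell] (Z : 𝔠.Cell) : mult ([] : List (𝔠.Cell × ℤ)) Z = 0 := rfl

theorem mult_cons [DecidableEq 𝔠.Cell] (p : 𝔠.Cell × ℤ) (l : List (𝔠.Cell × ℤ)) (Z : 𝔠.Cell) :
    mult (p :: l) Z = (if p.1 = Z then p.2 else 0) + mult l Z := by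
  simp [mult]

end MonadDesign

/-! ### the (H1) ∕ rank ∕ μ read-out on the BOX frame `CWord` -/

namespace MonadDesign

variable {𝔠 : CellAlphabet R CWord} (D : MonadDesign 𝔠)

/-- the RANK functional: `ch₀(𝓔)` = the coefficient of the word `1111`. -/
def rank : R := D.wch oneWord

/-- **(H1) of record**: `ch(𝓔)` passes the class screen (A1) (`Pad4TowerClassScreen.ClassScreen`: e-mixed words other than `eeee`, `ēēēē`
vanish; e-free words of equal degree agree). -/
def Clean : Prop := ClassScreen D.wch

/-- **the Weil charge** `μ(𝓔)` = the `eeee`-coefficient of `ch(𝓔)` (a SEED needs `μ ≠ 0`). -/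
def mu : R := D.wch eWord

/-- `μ̄` = the `ēēēē`-coefficient. -/
def muBar : R := D.wch ebarWord

theorem clean_ofCokernel_iff (Pr : Presentation 𝔠) : (ofCokernel Pr).Clean ↔ Pr.Clean := by
  rw [Clean, wch_ofCokernel]; exact Iff.rfl

theorem clean_ofKernel_iff (Pr : Presentation 𝔠) : (ofKernel Pr).Clean ↔ Pr.Clean := by
  rw [Clean, wch_ofKernel]; exact Iff.rfl

theorem mu_ofCokernel (Pr : Presentation 𝔠) : (ofCokernel Pr).mu = Pr.mu := by
  rw [mu, wch_ofCokernel]; rfl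

theorem mu_ofKernel (Pr : Presentation 𝔠) : (ofKernel Pr).mu = Pr.mu := by
  rw [mu, wch_ofKernel]; rfl

/-- **on a unital alphabet the rank functional is the copy count** `Σ m_N − Σ m_A − Σ m_C`. -/
theorem rank_eq_count (h𝔠 : 𝔠.Unital) : D.rank = (D.count : R) := by
  have h : ∀ X, 𝔠.ch X oneWord = 1 := h𝔠
  simp [rank, wch_apply, h, count]

end MonadDesign

namespace Presentation

variable {W : Type} {𝔠 : CellAlphabet R W}

/-- a two-term presentation from two association lists `(cell, multiplicity)` (design JSONs without `split`: keys `N`, `P`). -/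
def ofLists [DecidableEq 𝔠.Cell] (lN lP : List (𝔠.Cell × ℤ)) : Presentation 𝔠 :=
  ⟨(lN.map Prod.fst).toFinset, (lP.map Prod.fst).toFinset, MonadDesign.mult lN, MonadDesign.mult lP⟩

end Presentation

namespace MonadDesign

variable {W : Type} {𝔠 : CellAlphabet R W} (D : MonadDesign 𝔠)

/-! ## §3 Hall conditions at `Σ = ∅` (necessary generic-rank conditions) and flow certificates -/

/-- **(KI) UP-Hall**: `i` can be generically injective only if every set `U` of `A`-cells has `i`-live neighbourhood of `N`-mass
`≥` its `A`-mass.  Written filter-free (for every `W ⊆ N` CONTAINING the live neighbourhood of `U`) and over `powerset`s, so that it is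
DECIDABLE on concrete designs over alphabets with decidable `Live` (e.g. `bAlph`): kernel probes by `decide`. -/
abbrev HallI : Prop :=
  ∀ U ∈ D.A.powerset, ∀ W ∈ D.N.powerset, (∀ a ∈ U, ∀ n ∈ D.N, 𝔠.Live a n → n ∈ W) →
    ∑ a ∈ U, D.mA a ≤ ∑ n ∈ W, D.mN n

/-- **(KQ) DOWN-Hall**: `q` can be generically surjective only if every set `V` of `C`-cells is fed by `N`-mass `≥` its `C`-mass. -/
abbrev HallQ : Prop :=
  ∀ V ∈ D.C.powerset, ∀ W ∈ D.N.powerset, (∀ c ∈ V, ∀ n ∈ D.N, 𝔠.Live n c → n ∈ W) →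
    ∑ c ∈ V, D.mC c ≤ ∑ n ∈ W, D.mN n

/-- **(KJ) JOINT Hall with SHARED `N`-capacity** (crit-hsem-2 memo-02 A.2: `q ∘ i = 0`, `i` injective, `q` surjective force
`|U| + |V| ≤ |Γ(U) ∪ Γ⁻(V)|` for all `U ⊆ A`-copies, `V ⊆ C`-copies; = the combined bipartite graph `(A ⊔ C) → N`). -/
abbrev HallJ : Prop :=
  ∀ U ∈ D.A.powerset, ∀ V ∈ D.C.powerset, ∀ W ∈ D.N.powerset,
    (∀ a ∈ U, ∀ n ∈ D.N, 𝔠.Live a n → n ∈ W) → (∀ c ∈ V, ∀ n ∈ D.N, 𝔠.Live n c → n ∈ W) →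
      ∑ a ∈ U, D.mA a + ∑ c ∈ V, D.mC c ≤ ∑ n ∈ W, D.mN n

/-- joint Hall implies UP-Hall (`V = ∅`). -/
theorem hallI_of_hallJ (h : D.HallJ) : D.HallI := by
  intro U hU W hW hUW
  have := h U hU ∅ (Finset.empty_mem_powerset _) W hW hUW (by simp)
  simpa using this

/-- joint Hall implies DOWN-Hall (`U = ∅`). -/
theorem hallQ_of_hallJ (h : D.HallJ) : D.HallQ := by
  intro V hV W hW hVW
  have := h ∅ (Finset.empty_mem_powerset _) V hV W hW (by simp) hVW
  simpa using this

/-- joint Hall at `U = A`, `V = C`, `W = N` gives a non-negative copy count (rank `≥ 0`). -/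
theorem count_nonneg_of_hallJ (h : D.HallJ) : 0 ≤ D.count := by
  have := h D.A (Finset.mem_powerset.mpr subset_rfl) D.C (Finset.mem_powerset.mpr subset_rfl) D.N
    (Finset.mem_powerset.mpr subset_rfl) (fun _ _ n hn _ => hn) (fun _ _ n hn _ => hn)
  unfold count; linarith

/-- **A JOINT FLOW CERTIFICATE** (what the cell's exact max-flow ∕ LP instruments return: `hallmonad.py`, `killhall_lp.py`, `padflow.py`):
unit flows `πI a n` along `i`-live pairs and `πQ n c` along `q`-live pairs, saturating every `A`- and every `C`-cell, the two together
respecting each `N`-cell's capacity `m_N`. -/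
structure JointFlow where
  /-- flow on the ordered pair (A-cell, N-cell) -/
  πI : 𝔠.Cell → 𝔠.Cell → ℕ
  /-- flow on the ordered pair (N-cell, C-cell) -/
  πQ : 𝔠.Cell → 𝔠.Cell → ℕ
  liveI : ∀ a n, πI a n ≠ 0 → D.ILive a n
  liveQ : ∀ n c, πQ n c ≠ 0 → D.QLive n c
  satA : ∀ a ∈ D.A, (∑ n ∈ D.N, (πI a n : ℤ)) = D.mA a
  satC : ∀ c ∈ D.C, (∑ n ∈ D.N, (πQ n c : ℤ)) = D.mC c
  cap : ∀ n ∈ D.N, (∑ a ∈ D.A, (πI a n : ℤ)) + (∑ c ∈ D.C, (πQ n c : ℤ)) ≤ D.mN n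

/-- **weak duality**: a joint flow certificate proves joint Hall (flow across any cut `≤` cut capacity). -/
theorem hallJ_of_jointFlow (F : D.JointFlow) : D.HallJ := by
  intro U hU V hV W hW hUW hVW
  rw [Finset.mem_powerset] at hU hV hW
  -- A-side: the mass of `U` is its outflow, all of which lands in `W`
  have hA : ∑ a ∈ U, D.mA a = ∑ a ∈ U, ∑ n ∈ W, (F.πI a n : ℤ) := by
    refine Finset.sum_congr rfl fun a ha => ?_
    rw [← F.satA a (hU ha)]
    symm
    refine Finset.sum_subset hW fun n hn hnW => ?_
    by_contra h0
    exact hnW (hUW a ha n hn (F.liveI a n (by exact_mod_cast h0)).2.2)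
  have hC : ∑ c ∈ V, D.mC c = ∑ c ∈ V, ∑ n ∈ W, (F.πQ n c : ℤ) := by
    refine Finset.sum_congr rfl fun c hc => ?_
    rw [← F.satC c (hV hc)]
    symm
    refine Finset.sum_subset hW fun n hn hnW => ?_
    by_contra h0
    exact hnW (hVW c hc n hn (F.liveQ n c (by exact_mod_cast h0)).2.2)
  rw [hA, hC, Finset.sum_comm, Finset.sum_comm (s := V)]
  rw [← Finset.sum_add_distrib]
  refine Finset.sum_le_sum fun n hn => ?_
  have h1 : ∑ a ∈ U, (F.πI a n : ℤ) ≤ ∑ a ∈ D.A, (F.πI a n : ℤ) :=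
    Finset.sum_le_sum_of_subset_of_nonneg hU fun _ _ _ => by positivity
  have h2 : ∑ c ∈ V, (F.πQ n c : ℤ) ≤ ∑ c ∈ D.C, (F.πQ n c : ℤ) :=
    Finset.sum_le_sum_of_subset_of_nonneg hV fun _ _ _ => by positivity
  have h3 := F.cap n (hW hn)
  linarith

end MonadDesign

namespace Presentation

variable {W : Type} {𝔠 : CellAlphabet R W} (Pr : Presentation 𝔠)

/-- UP-Hall of a two-term presentation (HALL₀'s cokernel orientation: `⊕_P → ⊕_N` generically injective needs every set of `P`-cells
out-weighed by its live `N`-neighbourhood) = `HallI` of its UP embedding. -/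
abbrev HallUp : Prop := (MonadDesign.ofCokernel Pr).HallI

/-- DOWN-Hall (kernel orientation: `⊕_N → ⊕_P` generically surjective) = `HallQ` of its DOWN embedding. -/
abbrev HallDown : Prop := (MonadDesign.ofKernel Pr).HallQ

end Presentation

/-! ## §4 The integer balanced alphabet 𝔅(μ₄) of record; sub-line ∕ band cells; the apex (identity) cell -/

/-- the content `gcd(Δα, ΔRe β, ΔIm β)` of a difference. -/
def gcd3 (Δ : BPoint) : ℕ := Int.gcd (Int.gcd Δ.1 Δ.2.1) Δ.2.2

/-- **the Hom-dimension MODEL of record** on 𝔅(μ₄) (B0 (G1) = Lange–Birkenhake 3.5.10∕3.5.11 via memo-88 (iii) «h⁰ ∈ {0, K}»; in the TREE, per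
hsemireg-lit-9's locator 2967c3e2929503f3: `Literature.Geometry.Kaehler.ComplexTorus.AHData.hodgeNumber_eq_choose_mul_reducedPfaffian` (Lange 1.6.8),
`hodgeNumber_eq_zero_of_radical_char_ne_one` (the Pic⁰-dependence «h⁰ ∈ {0, K}»), `hodgeNumber_eq_ite_of_nondegenerate` (Mumford's index theorem) in
`Literature/Geometry/Kaehler/ComplexTorusLineBundleHodgeNumbers.lean`): `0` unless `Δ = y − x` is effective; `1` for `Δ = 0`; the content `gcd(Δ)` for a
non-zero NULL `Δ` (matched twist); `χ = Δα² − |Δβ|²` for a BIG `Δ` (absent from every design of record, memo-02 B.3 «never big»). A model wired to no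
theorem here; Hall reads `Live` only. -/
def homB (x y : BPoint) : ℕ :=
  if Effective (bsub y x) then
    (if (bsub y x).2.1 ^ 2 + (bsub y x).2.2 ^ 2 = (bsub y x).1 ^ 2 then max 1 (gcd3 (bsub y x))
      else ((bsub y x).1 ^ 2 - (bsub y x).2.1 ^ 2 - (bsub y x).2.2 ^ 2).toNat)
  else 0

/-- **THE INTEGER BALANCED LETTERS 𝔅(μ₄)** of the cell: letters `BPoint = (α, Re β, Im β)`, class map `bphi`
(`(1, α, α, β, β̄, α² − |β|²)`), live = `Effective (y − x)` (HALL₀'s rule «D = 0 ∨ (Δa > 0 ∧ Δa² ≥ Δx² + Δy²)», ×2 memo-02 B.3),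
Hom model `homB`. -/
abbrev bLetters : Alphabet GaussianInt :=
  { Letter := BPoint, phi := bphi, Live := fun x y => Effective (bsub y x), hom := homB }

/-- **THE INTEGER BALANCED (CELL) ALPHABET 𝔅(μ₄)**: the Künneth cells of `bLetters` — its cells ARE the tree's `MCell`s. -/
abbrev bAlph : CellAlphabet GaussianInt CWord := bLetters.toCell

theorem bLetters_unital : bLetters.Unital := fun x => bphi_zero x

theorem bAlph_unital : bAlph.Unital := bLetters.toCell_unital bLetters_unital

/-- the cells of `bAlph` are the tree's `MCell`s and the class tensor is `MCell.ch`. -/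
theorem cellCh_bAlph (Z : MCell) : bAlph.ch Z = Z.ch := rfl

theorem cellCh_bLetters (Z : MCell) : bLetters.cellCh Z = Z.ch := rfl

/-- liveness of `bAlph` cells is the tree's order `MCell.le` (`a ≤ n`: `n − a` effective on every factor). -/
theorem cellLive_bAlph_iff (a n : MCell) : bAlph.Live a n ↔ MCell.le a n := Iff.rfl

/-- live ⟺ the Hom model is non-zero. -/
theorem live_iff_homB_ne_zero (x y : BPoint) : bLetters.Live x y ↔ homB x y ≠ 0 := by
  show Effective (bsub y x) ↔ homB x y ≠ 0
  unfold homB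
  by_cases h : Effective (bsub y x)
  · refine ⟨fun _ => ?_, fun _ => h⟩
    rw [if_pos h]
    split_ifs with h1
    · exact Nat.one_le_iff_ne_zero.mp (le_max_left _ _)
    · have hlt : (bsub y x).2.1 ^ 2 + (bsub y x).2.2 ^ 2 < (bsub y x).1 ^ 2 := lt_of_le_of_ne h.2 h1
      intro h0
      rw [Int.toNat_eq_zero] at h0
      linarith
  · rw [if_neg h]
    simp [h]

namespace Presentation

/-- the tree's two-term object: an `MConfig` with multiplicities IS a presentation over `bAlph`. -/
def ofMConfig (C : MConfig) (mN mP : MCell → ℤ) : Presentation bAlph := ⟨C.lower, C.upper, mN, mP⟩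

/-- … with the SAME weighted class tensor `MConfig.wch` — so every tree theorem about `ClassScreen (C.wch mN mP)` (Ψ-row, (M), the DOWN∕UP
two-term laws of `LinePhaseTorus`) is a theorem about `(ofMConfig C mN mP).Clean`. -/
theorem wch_ofMConfig (C : MConfig) (mN mP : MCell → ℤ) : (ofMConfig C mN mP).wch = C.wch mN mP := rfl

theorem clean_ofMConfig_iff (C : MConfig) (mN mP : MCell → ℤ) :
    (ofMConfig C mN mP).Clean ↔ ClassScreen (C.wch mN mP) := Iff.rfl

/-- back to the tree's object. -/
def toMConfig (Pr : Presentation bAlph) : MConfig := ⟨Pr.N, Pr.P⟩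

theorem wch_toMConfig (Pr : Presentation bAlph) : Pr.toMConfig.wch Pr.mN Pr.mP = Pr.wch := rfl

end Presentation

namespace MonadDesign

/-- **μ as a letter sum** on 𝔅(μ₄): `μ(𝓔) = Σ_N m Π_f β_f − Σ_A m Π_f β_f − Σ_C m Π_f β_f` (`LinePhaseTorus.ch_eWord`). -/
theorem mu_eq_sum_prod_betaG (D : MonadDesign bAlph) :
    D.mu = (∑ Z ∈ D.N, (D.mN Z : GaussianInt) * ∏ f, betaG Z f)
      - (∑ Z ∈ D.A, (D.mA Z : GaussianInt) * ∏ f, betaG Z f) - ∑ Z ∈ D.C, (D.mC Z : GaussianInt) * ∏ f, betaG Z f := by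
  rw [mu, wch_apply]
  simp only [cellCh_bLetters, ch_eWord]

/-- on 𝔅(μ₄) the rank functional is the copy count. -/
theorem rank_bAlph (D : MonadDesign bAlph) : D.rank = (D.count : GaussianInt) := D.rank_eq_count bAlph_unital

/-- `P = A ⊔ C` with `m_P = m_A + m_C`: the two-term SHADOW of a monad design (same cells, outer terms merged) — it has the same class
tensor when `m_A`, `m_C` vanish off their supports (`wch_shadow`). -/
def shadow (D : MonadDesign bAlph) : Presentation bAlph := ⟨D.N, D.A ∪ D.C, D.mN, fun Z => D.mA Z + D.mC Z⟩

theorem wch_shadow (D : MonadDesign bAlph) (hA : ∀ Z ∉ D.A, D.mA Z = 0) (hC : ∀ Z ∉ D.C, D.mC Z = 0) :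
    D.shadow.wch = D.wch := by
  have h1 : ∑ Z ∈ D.A ∪ D.C, D.mA Z • bAlph.ch Z = ∑ Z ∈ D.A, D.mA Z • bAlph.ch Z :=
    (Finset.sum_subset Finset.subset_union_left fun Z _ hZ => by simp [hA Z hZ]).symm
  have h2 : ∑ Z ∈ D.A ∪ D.C, D.mC Z • bAlph.ch Z = ∑ Z ∈ D.C, D.mC Z • bAlph.ch Z :=
    (Finset.sum_subset Finset.subset_union_right fun Z _ hZ => by simp [hC Z hZ]).symm
  simp only [Presentation.wch, shadow, wch, add_smul, Finset.sum_add_distrib, h1, h2]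
  abel

end MonadDesign

/-- a SUB-LINE cell of height `h`: every letter is an AXIS letter `aI + c·ℓ_u` lying on SOME line `α + c = t` with `t ≤ h`
(`lineLetter t c k`); the box under the LINE `h`. -/
def SubLineCell (h : ℤ) (Z : MCell) : Prop := ∀ f, ∃ t : ℤ, t ≤ h ∧ ∃ c : ℕ, ∃ k : Fin 4, Z f = lineLetter t c k

/-- a BAND cell: every letter on a line of height `t ∈ [h − w, h]` (BAND-4@12 support M of memo-05 §4 = `BandCell 12 4`, tops 8∕10∕12). -/
def BandCell (h : ℤ) (w : ℕ) (Z : MCell) : Prop :=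
  ∀ f, ∃ t : ℤ, h - w ≤ t ∧ t ≤ h ∧ ∃ c : ℕ, ∃ k : Fin 4, Z f = lineLetter t c k

/-- **the LINE-`h` letter universe OF RECORD** (π1, idea-crit-hsem-3 memo-h3-02 ∕ director: `LineCell` above quantifies the charge `c ∈ ℕ` unboundedly and
so contains the non-effective points `(h − c, c·ζ̄)`, `c > h∕2`; the census universe is `c ≤ h∕2`): every letter is `lineLetter h c k` with `2c ≤ h`.  Use THIS
variant wherever a finite CENSUS ∕ LP fact is imported as a hypothesis; keep `LineCell` for laws. -/
def LineCellStd (h : ℤ) (Z : MCell) : Prop := ∀ f, ∃ c : ℕ, ∃ k : Fin 4, 2 * (c : ℤ) ≤ h ∧ Z f = lineLetter h c k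

/-- **the BAND universe OF RECORD**: EVEN tops `t ∈ [h − w, h]` and charges `2c ≤ t` (BAND-4@12 = `BandCellStd 12 4`: tops `{8, 10, 12}`, 63 letters —
`bandLetters_card`). -/
def BandCellStd (h : ℤ) (w : ℕ) (Z : MCell) : Prop :=
  ∀ f, ∃ t : ℤ, h - w ≤ t ∧ t ≤ h ∧ Even t ∧ ∃ c : ℕ, ∃ k : Fin 4, 2 * (c : ℤ) ≤ t ∧ Z f = lineLetter t c k

theorem lineCell_of_lineCellStd {h : ℤ} {Z : MCell} (hZ : LineCellStd h Z) : LineCell h Z := fun f => by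
  obtain ⟨c, k, -, e⟩ := hZ f
  exact ⟨c, k, e⟩

theorem bandCell_of_bandCellStd {h : ℤ} {w : ℕ} {Z : MCell} (hZ : BandCellStd h w Z) : BandCell h w Z := fun f => by
  obtain ⟨t, h1, h2, -, c, k, -, e⟩ := hZ f
  exact ⟨t, h1, h2, c, k, e⟩

theorem lineCellStd_of_bandCellStd_zero {h : ℤ} {Z : MCell} (hZ : BandCellStd h 0 Z) : LineCellStd h Z := fun f => by
  obtain ⟨t, h1, h2, -, c, k, hc, e⟩ := hZ f
  have : t = h := by push_cast at h1; linarith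
  subst this
  exact ⟨c, k, hc, e⟩

/-- the letters of the band universe as a list: even tops `t = h − w, …, h` (for even `h − w`), charge `c ≤ t∕2`, one phase for `c = 0` and four otherwise. -/
def bandLetters (h w : ℕ) : List BPoint :=
  ((List.range (w / 2 + 1)).map fun j => h - w + 2 * j).flatMap fun t =>
    (List.range (t / 2 + 1)).flatMap fun c =>
      if c = 0 then [lineLetter t 0 0] else (List.finRange 4).map fun k => lineLetter t c k

/-- BAND-4@12 has exactly `63` letters (`17 + 21 + 25` at tops `8, 10, 12`), pairwise distinct; the LINE-14 universe (`bandLetters 14 0`) has `29`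
(memo-02 B.3 «all 29 × 29 LINE-14 letter pairs»). [`decide`] -/
theorem bandLetters_card : (bandLetters 12 4).length = 63 ∧ (bandLetters 12 4).Nodup ∧
    (bandLetters 14 0).length = 29 ∧ (bandLetters 14 0).Nodup := by
  decide

/-- LINE cells are sub-line cells. -/
theorem subLineCell_of_lineCell {h : ℤ} {Z : MCell} (hZ : LineCell h Z) : SubLineCell h Z := fun f => by
  obtain ⟨c, k, e⟩ := hZ f
  exact ⟨h, le_rfl, c, k, e⟩

/-- band cells are sub-line cells. -/
theorem subLineCell_of_bandCell {h : ℤ} {w : ℕ} {Z : MCell} (hZ : BandCell h w Z) : SubLineCell h Z := fun f => by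
  obtain ⟨t, -, ht, c, k, e⟩ := hZ f
  exact ⟨t, ht, c, k, e⟩

/-- LINE cells are exactly the band cells of width `0`. -/
theorem bandCell_zero_iff_lineCell (h : ℤ) (Z : MCell) : BandCell h 0 Z ↔ LineCell h Z := by
  constructor
  · intro hZ f
    obtain ⟨t, h1, h2, c, k, e⟩ := hZ f
    have : t = h := by push_cast at h1; linarith
    exact ⟨c, k, this ▸ e⟩
  · intro hZ f
    obtain ⟨c, k, e⟩ := hZ f
    exact ⟨h, by simp, le_rfl, c, k, e⟩

/-- widening the band keeps its cells. -/
theorem bandCell_mono {h : ℤ} {w w' : ℕ} (hw : w ≤ w') {Z : MCell} (hZ : BandCell h w Z) : BandCell h w' Z := fun f => by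
  obtain ⟨t, h1, h2, c, k, e⟩ := hZ f
  exact ⟨t, by linarith [(Nat.cast_le (α := ℤ)).mpr hw], h2, c, k, e⟩

/-- the APEX (identity, hub) cell `[hI | hI | hI | hI]`. -/
def apexCell (h : ℤ) : MCell := fun _ => lineLetter h 0 0

theorem apexCell_apply (h : ℤ) (f : Fin 4) : apexCell h f = (h, 0, 0) := by
  simp [apexCell, lineLetter]

theorem lineCell_apexCell (h : ℤ) : LineCell h (apexCell h) := fun _ => ⟨0, 0, rfl⟩

/-- **hub liveness** (crit memo-02 A.1 (i), here for the whole box): every sub-line cell maps live INTO the apex cell. -/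
theorem le_apexCell {h : ℤ} {Z : MCell} (hZ : SubLineCell h Z) : MCell.le Z (apexCell h) := by
  intro f
  obtain ⟨t, ht, c, k, e⟩ := hZ f
  rw [e, apexCell_apply]
  have hc : (0 : ℤ) ≤ c := by exact_mod_cast Nat.zero_le c
  fin_cases k <;> simp [lineLetter, Effective] <;> constructor <;> nlinarith

/-- … and conversely FROM the apex only the apex is live (memo-02 A.1 (i): `hI → λ(ζ′, b′)` has `D = −b′ℓ₋ζ′`). -/
theorem eq_apexCell_of_le {h : ℤ} {Z : MCell} (hZ : SubLineCell h Z) (hle : MCell.le (apexCell h) Z) : Z = apexCell h := by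
  funext f
  obtain ⟨t, ht, c, k, e⟩ := hZ f
  have h1 := hle f
  rw [e, apexCell_apply] at h1
  rw [e, apexCell_apply]
  have hc : (0 : ℤ) ≤ c := by exact_mod_cast Nat.zero_le c
  rcases h1 with ⟨h1, h2⟩
  simp [lineLetter] at h1 h2
  have hc0 : (c : ℤ) = 0 := by linarith
  have ht0 : t = h := by linarith
  subst ht0
  fin_cases k <;> simp [lineLetter, hc0]

/-- the letter vector of the apex letter `hI`: `(1, h, h, 0, 0, h²)` (e-free: `e^{hI}`). -/
theorem bphi_apex (h : ℤ) (l : Fin 6) :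
    bphi (h, 0, 0) l = if l = 3 ∨ l = 4 then 0 else (h : GaussianInt) ^ ldeg l := by
  fin_cases l <;> simp [bphi, phiVec, ldeg, Zsqrtd.ext_iff]

/-- the class tensor of the apex cell: `h^{deg w}` on e-free words, `0` on the others (`ch = e^{hΘ}`). -/
theorem ch_apexCell (h : ℤ) (w : CWord) :
    (apexCell h).ch w = if EFree w then (h : GaussianInt) ^ wdeg w else 0 := by
  by_cases hw : EFree w
  · rw [if_pos hw, ch_eq_prod, Fin.prod_univ_four]
    simp only [apexCell_apply, bphi_apex]
    have h0 := hw 0; have h1 := hw 1; have h2 := hw 2; have h3 := hw 3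
    rw [if_neg (by tauto), if_neg (by tauto), if_neg (by tauto), if_neg (by tauto), wdeg]
    ring
  · rw [if_neg hw, ch_eq_prod]
    simp only [EFree, not_forall, not_and_or, not_not] at hw
    obtain ⟨f, hf⟩ := hw
    apply Finset.prod_eq_zero (Finset.mem_univ f)
    rw [apexCell_apply, bphi_apex, if_pos hf]

/-- **the identity summand is clean with `μ = 0`**: the one-cell presentation `m·[hI⁴]` (any `m`, either side empty) passes (A1), has
rank `m` and `μ = 0` — the class-level half of the hub facts (memo-02 A.1 (ii), A.5) and of RULE B's shape «`ch = m·e^{hΘ}`». -/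
theorem apex_clean (h m : ℤ) :
    (⟨{apexCell h}, ∅, fun _ => m, fun _ => 0⟩ : Presentation bAlph).Clean ∧
      (⟨{apexCell h}, ∅, fun _ => m, fun _ => 0⟩ : Presentation bAlph).mu = 0 ∧
      (⟨{apexCell h}, ∅, fun _ => m, fun _ => 0⟩ : Presentation bAlph).count = m := by
  have hw : (⟨{apexCell h}, ∅, fun _ => m, fun _ => 0⟩ : Presentation bAlph).wch =
      fun w => if EFree w then (m : GaussianInt) * (h : GaussianInt) ^ wdeg w else 0 := by
    funext w
    simp [Presentation.wch, cellCh_bLetters, ch_apexCell, zsmul_eq_mul]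
  refine ⟨?_, ?_, by simp [Presentation.count]⟩
  · rw [Presentation.Clean, hw]
    refine ⟨fun w hw' _ _ => ?_, fun w w' hw1 hw2 hd => ?_⟩
    · dsimp only
      rw [if_neg hw']
    · dsimp only
      rw [if_pos hw1, if_pos hw2, hd]
  · rw [Presentation.mu, hw]
    dsimp only
    rw [if_neg (by decide)]

/-! ## §5 Clearing denominators; the BOX semi-homogeneous alphabet; unbalanced and isogeny letters -/

/-- scaling a balanced letter by an integer: `s·(α, β) = (sα, sβ)`. -/
def bscale (s : ℤ) (x : BPoint) : BPoint := (s * x.1, s * x.2.1, s * x.2.2)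

/-- DEGREE SCALING of a class function: `(D_s T)(w) = s^{deg w} · T(w)`. -/
def degScale (s : R) (T : CWord → R) : CWord → R := fun w => s ^ wdeg w * T w

/-- the letter vector of a scaled letter: entry `l` scales by `s^{deg l}` (`(1, sα, sα, sβ, sβ̄, s²(α² − |β|²))`). -/
theorem bphi_bscale (s : ℤ) (x : BPoint) (l : Fin 6) : bphi (bscale s x) l = (s : GaussianInt) ^ ldeg l * bphi x l := by
  obtain ⟨a, re, im⟩ := x
  fin_cases l
  · simp [bphi, phiVec, bscale, ldeg]
  · simp [bphi, phiVec, bscale, ldeg]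
  · simp [bphi, phiVec, bscale, ldeg]
  · simp [bphi, phiVec, bscale, ldeg]
  · simp [bphi, phiVec, bscale, ldeg]
  · simp [bphi, phiVec, bscale, ldeg]
    ring

/-- the class tensor of a factorwise-scaled cell is the degree-scaled class tensor. -/
theorem ch_bscale (s : ℤ) (Z : MCell) : MCell.ch (fun f => bscale s (Z f)) = degScale (s : GaussianInt) Z.ch := by
  funext w
  simp only [degScale, ch_eq_prod, bphi_bscale, Fin.prod_univ_four, wdeg]
  ring

/-- degree scaling preserves the class screen (A1). -/
theorem classScreen_degScale {T : CWord → R} (hT : ClassScreen T) (s : R) : ClassScreen (degScale s T) := by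
  refine ⟨fun w h1 h2 h3 => ?_, fun w w' h1 h2 hd => ?_⟩
  · simp [degScale, hT.1 w h1 h2 h3]
  · simp [degScale, hT.2 w w' h1 h2 hd, hd]

/-- **CLEARING DENOMINATORS** (the reduction ×2 control∕semihom-1, R19.162: rational-letter design at scale `s` ↦ integer design, CLEAN ↦ CLEAN
both ways): for a non-zero-divisor `s`, `T` passes (A1) iff `D_s T` does. -/
theorem classScreen_degScale_iff [IsDomain R] {s : R} (hs : s ≠ 0) (T : CWord → R) :
    ClassScreen (degScale s T) ↔ ClassScreen T := by
  refine ⟨fun h => ⟨fun w h1 h2 h3 => ?_, fun w w' h1 h2 hd => ?_⟩, fun h => classScreen_degScale h s⟩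
  · have := h.1 w h1 h2 h3
    simp only [degScale, mul_eq_zero, pow_eq_zero_iff', ne_eq] at this
    tauto
  · have := h.2 w w' h1 h2 hd
    simp only [degScale, hd] at this
    exact mul_left_cancel₀ (pow_ne_zero _ hs) this

/-- the `eeee`-coefficient scales by `s⁴` (so `μ ≠ 0` is scale-invariant for `s ≠ 0`). -/
theorem degScale_eWord (s : R) (T : CWord → R) : degScale s T eWord = s ^ 4 * T eWord := by
  simp [degScale, wdeg, eWord, ldeg]

/-- the `1111`-coefficient (rank) is scale-invariant. -/
theorem degScale_oneWord (s : R) (T : CWord → R) : degScale s T oneWord = T oneWord := by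
  simp [degScale, wdeg, oneWord, ldeg]

/-- **A SEMI-HOMOGENEOUS (BOX) LETTER** (semihom-1 §A–§B; Mukai 1978 Thm 5.8 ∕ Prop 5.9 ∕ Thm 7.11): a simple semi-homogeneous bundle on
one factor with SLOPE `δ = num ∕ den ∈ NS(S)_ℚ` (balanced frame coordinates) and RANK WEIGHT `rk`, `ch = rk · e^{δ}`.  Data only: that a given
`(num, den, rk)` is realised (e.g. `rk = den` on the LINE, semihom-1 (A.1)) is the SPEC's sentence, not this file's. -/
structure SemihomLetter where
  /-- numerator of the slope (balanced frame `(α, Re β, Im β)`) -/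
  num : BPoint
  /-- denominator of the slope -/
  den : ℕ+
  /-- rank weight -/
  rk : ℕ+
deriving DecidableEq

namespace SemihomLetter

/-- integer letters (line bundles) are the rank-one box letters with denominator `1`. -/
def ofPt (x : BPoint) : SemihomLetter := ⟨x, 1, 1⟩

@[simp] theorem ofPt_num (x : BPoint) : (ofPt x).num = x := rfl
@[simp] theorem ofPt_den (x : BPoint) : (ofPt x).den = 1 := rfl
@[simp] theorem ofPt_rk (x : BPoint) : (ofPt x).rk = 1 := rfl

/-- the numerator written at the common SCALE `L`: `(L ∕ den) · num` (exact when `den ∣ L`). -/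
def atScale (L : ℕ) (x : SemihomLetter) : BPoint := bscale ((L / (x.den : ℕ) : ℕ) : ℤ) x.num

/-- semihom-1 (A.1)'s LINE letter of charge `c = C ∕ l` and phase `k`: slope `(h − c, c·conj(i^k))`, numerator `lineLetter (h·l) C k` over `l`,
rank weight `l` (their table: `r(E_x) = l`, `χ = 28·l·(7 − c)` at `h = 14`). -/
def onLine (h : ℤ) (C : ℕ) (l : ℕ+) (k : Fin 4) : SemihomLetter := ⟨lineLetter (h * l) C k, l, l⟩

theorem atScale_ofPt (L : ℕ) (x : BPoint) : (ofPt x).atScale L = bscale L x := by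
  simp [atScale]

theorem atScale_one_ofPt (x : BPoint) : (ofPt x).atScale 1 = x := by
  obtain ⟨a, re, im⟩ := x
  simp [atScale_ofPt, bscale]

/-- an integer letter's box version has denominator `1`; the half-integer line letter `c = 1∕2` (semihom-1 §E's `S′_{1∕2}`) does not. -/
theorem onLine_half_ne_ofPt (h : ℤ) (k : Fin 4) (x : BPoint) : onLine h 1 2 k ≠ ofPt x := by
  intro e
  have h2 := congrArg (fun y => (y.den : ℕ)) e
  simp only [onLine, ofPt_den] at h2
  exact absurd h2 (by decide)

end SemihomLetter

/-- the Hom model read AT SCALE `L` (slopes `= numerator ∕ L`): `0` unless live; `1` on `Δ = 0`; `content(Δ) ∕ L` on a non-zero null `Δ` (on the LINE: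
`h⁰ = Δc` in slope units, semihom-1 §C); `χ(Δ) ∕ L²` on a big `Δ` (χ is quadratic).  ℕ-division: exact on genuine letters whose denominators divide `L`;
a model (π2 of idea-crit-hsem-3 memo-h3-02: v1.1 divided both cases by `L`). -/
def homAtScale (L : ℕ) (x y : BPoint) : ℕ :=
  if Effective (bsub y x) then
    (if bsub y x = (0, 0, 0) then 1
      else if (bsub y x).2.1 ^ 2 + (bsub y x).2.2 ^ 2 = (bsub y x).1 ^ 2 then gcd3 (bsub y x) / L
      else ((bsub y x).1 ^ 2 - (bsub y x).2.1 ^ 2 - (bsub y x).2.2 ^ 2).toNat / L ^ 2)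
  else 0

/-- **THE BOX SEMI-HOMOGENEOUS ALPHABET at scale `L`** (semihom-1 §B–§C: `ch(E_x) = rk·e^{δ}`; «dead unless `Δ = 0` or `Δ` nef-isotropic on the
same ray — exactly the integer rule»; `hom_live = r r′ Δc`): letters `SemihomLetter`, class map `rk · bphi(numerator at scale L)` (= `D_L` of the
rational letter vector), live = `Effective` on scaled numerators, Hom model `rk·rk′·homAtScale L` (content `∕ L` on null steps, `χ ∕ L²` on big ones;
exactness is the SPEC's business).  Meaningful on designs whose denominators divide `L`. -/
abbrev boxLetters (L : ℕ) : Alphabet GaussianInt :=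
  { Letter := SemihomLetter
    phi := fun x l => ((x.rk : ℕ) : GaussianInt) * bphi (x.atScale L) l
    Live := fun x y => Effective (bsub (y.atScale L) (x.atScale L))
    hom := fun x y => (x.rk : ℕ) * (y.rk : ℕ) * homAtScale L (x.atScale L) (y.atScale L) }

/-- the BOX (cell) alphabet: Künneth cells of `boxLetters L`. -/
abbrev boxAlphabet (L : ℕ) : CellAlphabet GaussianInt CWord := (boxLetters L).toCell

/-- **A BOX CELL**: a cell of the box alphabet — the box `⊠_f E_{x_f}` of four semi-homogeneous letters (semihom-1 (A.3), rank weight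
`Π_f rk_f`). -/
abbrev BoxCell (L : ℕ) : Type := (boxLetters L).Cell

namespace BoxCell

/-- integer cells (`MCell`, in particular every `LineCell`) are box cells: rank weight `1`, denominator `1` on every factor. -/
def ofMCell (L : ℕ) (Z : MCell) : BoxCell L := fun f => SemihomLetter.ofPt (Z f)

/-- the rank weight `R(X) = Π_f rk_f` of a box cell. -/
def rkw {L : ℕ} (X : BoxCell L) : ℕ := ∏ f, ((X f).rk : ℕ)

theorem rkw_ofMCell (L : ℕ) (Z : MCell) : rkw (ofMCell L Z) = 1 := by
  simp [rkw, ofMCell]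

/-- the rank functional reads the rank weight: `ch₀(⊠_f E_{x_f}) = Π_f rk_f` (semihom-1 §D: «γ in RANK UNITS»). -/
theorem cellCh_oneWord {L : ℕ} (X : BoxCell L) : (boxAlphabet L).ch X oneWord = (rkw X : GaussianInt) := by
  simp [Alphabet.cellCh_apply, boxLetters, oneWord, bphi_zero, rkw, Fin.prod_univ_four]

/-- at scale `1` the embedding preserves the class tensor: `ch(ofMCell Z) = ch(Z)`. -/
theorem cellCh_ofMCell_one (Z : MCell) : (boxAlphabet 1).ch (ofMCell 1 Z) = Z.ch := by
  funext w
  simp [Alphabet.cellCh, ofMCell, SemihomLetter.atScale_one_ofPt, MCell.ch]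

/-- at scale `L` the embedding is the degree scaling `D_L` of the class tensor (the integer design read at scale `L`). -/
theorem cellCh_ofMCell (L : ℕ) (Z : MCell) :
    (boxAlphabet L).ch (ofMCell L Z) = degScale ((L : ℤ) : GaussianInt) Z.ch := by
  rw [← ch_bscale]
  funext w
  simp [Alphabet.cellCh, ofMCell, SemihomLetter.atScale_ofPt, MCell.ch]

/-- liveness of embedded integer cells at scale `L ≥ 1` is the integer liveness (the cone rule is scale-invariant). -/
theorem cellLive_ofMCell_iff {L : ℕ} (hL : 0 < L) (a n : MCell) :
    (boxAlphabet L).Live (ofMCell L a) (ofMCell L n) ↔ MCell.le a n := by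
  have hL' : (0 : ℤ) < L := by exact_mod_cast hL
  refine forall_congr' fun f => ?_
  show Effective (bsub ((SemihomLetter.ofPt (n f)).atScale L) ((SemihomLetter.ofPt (a f)).atScale L)) ↔
    Effective (bsub (n f) (a f))
  rw [SemihomLetter.atScale_ofPt, SemihomLetter.atScale_ofPt]
  generalize a f = x
  generalize n f = y
  obtain ⟨a1, a2, a3⟩ := x
  obtain ⟨n1, n2, n3⟩ := y
  simp only [bscale, Effective]
  constructor
  · rintro ⟨h1, h2⟩
    refine ⟨by nlinarith, ?_⟩
    have : (L : ℤ) ^ 2 * ((n2 - a2) ^ 2 + (n3 - a3) ^ 2) ≤ (L : ℤ) ^ 2 * (n1 - a1) ^ 2 := by nlinarith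
    exact le_of_mul_le_mul_left this (by positivity)
  · rintro ⟨h1, h2⟩
    exact ⟨by nlinarith, by nlinarith [mul_le_mul_of_nonneg_left h2 (sq_nonneg (L : ℤ))]⟩

/-- **`BoxCell ⊋` integer cells**: the all-`c = 1∕2` rank-`16` box cell at `h = 14` is no `ofMCell` image. -/
theorem halfCell_not_ofMCell (L : ℕ) (Z : MCell) :
    (fun _ => SemihomLetter.onLine 14 1 2 0 : BoxCell L) ≠ ofMCell L Z := by
  intro e
  exact SemihomLetter.onLine_half_ne_ofPt 14 0 (Z 0) (congrFun e 0)

end BoxCell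

/-- an UNBALANCED integer letter `(α, α′, Re β, Im β)` ∈ `NS(S) = Herm₂(ℤ[i])` (pad4lib `blk(α, α′, β)`; the balanced lattice 𝔅(μ₄) is
`α = α′`) — room for the «new ch-directions» of blocks B3∕B4 (isogeny pushforwards, Fourier–Mukai transforms need not stay balanced). -/
abbrev GPoint : Type := ℤ × ℤ × ℤ × ℤ

/-- the letter vector `(1, α, α′, β, β̄, αα′ − |β|²)` of an unbalanced letter (pad4lib `phi(blk(α, α′, β))`). -/
def uphi (x : GPoint) : Fin 6 → GaussianInt :=
  ![1, (x.1 : GaussianInt), (x.2.1 : GaussianInt), ⟨x.2.2.1, x.2.2.2⟩, ⟨x.2.2.1, -x.2.2.2⟩,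
    ((x.1 * x.2.1 - x.2.2.1 ^ 2 - x.2.2.2 ^ 2 : ℤ) : GaussianInt)]

/-- the balanced letters inside the unbalanced ones. -/
def GPoint.ofB (x : BPoint) : GPoint := (x.1, x.1, x.2.1, x.2.2)

/-- consistency: on balanced letters `uphi = bphi`. -/
theorem uphi_ofB (x : BPoint) : uphi (GPoint.ofB x) = bphi x := by
  funext l
  fin_cases l
  · simp [uphi, GPoint.ofB, bphi, phiVec]
  · simp [uphi, GPoint.ofB, bphi, phiVec]
  · simp [uphi, GPoint.ofB, bphi, phiVec]
  · simp [uphi, GPoint.ofB, bphi, phiVec]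
  · simp [uphi, GPoint.ofB, bphi, phiVec]
  · simp [uphi, GPoint.ofB, bphi, phiVec]
    ring

/-- effectivity for unbalanced differences: `Δ` nef (`Δα, Δα′ ≥ 0`, `Δα·Δα′ ≥ |Δβ|²`). -/
abbrev GEffective (Δ : GPoint) : Prop := 0 ≤ Δ.1 ∧ 0 ≤ Δ.2.1 ∧ Δ.2.2.1 ^ 2 + Δ.2.2.2 ^ 2 ≤ Δ.1 * Δ.2.1

theorem gEffective_ofB_iff (Δ : BPoint) : GEffective (GPoint.ofB Δ) ↔ Effective Δ := by
  obtain ⟨a, re, im⟩ := Δ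
  simp only [GEffective, GPoint.ofB, Effective]
  constructor
  · rintro ⟨h1, -, h3⟩; exact ⟨h1, by nlinarith⟩
  · rintro ⟨h1, h2⟩; exact ⟨h1, h1, by nlinarith⟩

/-- componentwise difference of unbalanced letters. -/
abbrev gsub (x y : GPoint) : GPoint := (x.1 - y.1, x.2.1 - y.2.1, x.2.2.1 - y.2.2.1, x.2.2.2 - y.2.2.2)

/-- the UNBALANCED integer alphabet (line bundles of arbitrary class in `NS(S)`): class map `uphi`, live = `GEffective`, Hom model `0∕1`
(live indicator only — no dimension model is of record off the balanced lattice). -/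
abbrev gLetters : Alphabet GaussianInt :=
  { Letter := GPoint, phi := uphi, Live := fun x y => GEffective (gsub y x)
    hom := fun x y => if GEffective (gsub y x) then 1 else 0 }

theorem gLetters_unital : gLetters.Unital := fun x => by simp [uphi]

/-- the unbalanced integer (cell) alphabet. -/
abbrev gAlph : CellAlphabet GaussianInt CWord := gLetters.toCell

/-- **AN ISOGENY-PUSHFORWARD LETTER** (block B3, alphabet-isogeny-1): the datum `(deg π, π_*[L])` of an isogeny `π : S′ → S` and a line bundle
`L` on `S′`; modelling sentence (Mukai 1978 §5: `π_*L` is semi-homogeneous of rank `deg π`, `ch = deg π · e^{π_*[L] ∕ deg π}`) — typed as the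
box letter `⟨push, deg, deg⟩`; which `(deg, push)` occur and their (H1) rows are the SPEC's table, not this file's. -/
structure IsogenyLetter where
  /-- degree of the isogeny -/
  deg : ℕ+
  /-- balanced frame coordinates of `π_*[L]` -/
  push : BPoint
deriving DecidableEq

/-- an isogeny letter as a box letter: slope `push ∕ deg`, rank weight `deg`. -/
def IsogenyLetter.toSemihom (x : IsogenyLetter) : SemihomLetter := ⟨x.push, x.deg, x.deg⟩

theorem IsogenyLetter.toSemihom_rk (x : IsogenyLetter) : x.toSemihom.rk = x.deg := rfl

/-! ## §5b The UNIPOTENT letters (block B2, alphabet-unipotent-1 `SPEC-UNIPOTENT-LINE` v1.1 2121f995 §1–§2; director R19.217 (3): ×1, OPEN through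
dedicated receivers ∕ design) — class level only

A unipotent letter on one factor is `(Z_f, T_f)`: a line letter `Z_f ∈ 𝔅(μ₄)` and a finite-length module `T_f` (Jordan type); its bundle is
`U_{T_f} ⊗ L_{Z_f}` of rank `m_f = dim T_f`.  LEMMA CH (their §2): `ch(U_T ⊗ L_Z) = (dim T)·ch(L_Z)` — the alphabet is CLASS-NEUTRAL; live Hom
spaces are those of the line letters (§0 «keeps every live Hom space non-zero»); what changes is WHERE sections vanish (SOCLE-KILL, §5) — a
map-level datum this vocabulary does not carry.  Typed: the letter `(Z, m)` with `phi = m • bphi Z`, live = the integer rule, Hom model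
`m·m′·homB` (an UPPER bound; the socle law cuts it — model only); `unipAlphabet = unipLetters.toCell`; kernel form of LEMMA CH:
`cellCh_unip` (`ch = (Π_f m_f) · ch(L_Z)`). -/

/-- a UNIPOTENT letter at class level: line letter `pt` and multiplicity `m = dim T` (the Jordan type itself is map-level data, not carried). -/
structure UnipLetter where
  /-- the line letter `Z_f` -/
  pt : BPoint
  /-- `m = dim T_f ≥ 1` -/
  m : ℕ+
deriving DecidableEq

/-- the unipotent letters: `phi (Z, m) = m • bphi Z` (LEMMA CH), live = `Effective` on the line letters, Hom model `m·m′·homB` (upper bound). -/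
abbrev unipLetters : Alphabet GaussianInt :=
  { Letter := UnipLetter
    phi := fun x l => ((x.m : ℕ) : GaussianInt) * bphi x.pt l
    Live := fun x y => Effective (bsub y.pt x.pt)
    hom := fun x y => (x.m : ℕ) * (y.m : ℕ) * homB x.pt y.pt }

/-- the unipotent (cell) alphabet. -/
abbrev unipAlphabet : CellAlphabet GaussianInt CWord := unipLetters.toCell

/-- the underlying line-bundle cell and the total multiplicity `Π_f m_f` of a unipotent cell. -/
def UnipLetter.lineCell (X : unipLetters.Cell) : MCell := fun f => (X f).pt

/-- total multiplicity `Π_f m_f` (= rank of `⊠_f U_{T_f} ⊗ L_{Z_f}`). -/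
def UnipLetter.mult (X : unipLetters.Cell) : ℕ := ∏ f, ((X f).m : ℕ)

/-- **LEMMA CH in kernel form**: the class tensor of a unipotent cell is `(Π_f m_f)` times the class tensor of its line-bundle cell — the alphabet
creates no class, no (H1) row, no μ beyond multiplicities. -/
theorem cellCh_unip (X : unipLetters.Cell) (w : CWord) :
    unipAlphabet.ch X w = (UnipLetter.mult X : GaussianInt) * (UnipLetter.lineCell X).ch w := by
  simp only [Alphabet.cellCh_apply, unipLetters, UnipLetter.mult, UnipLetter.lineCell, ch_eq_prod, Fin.prod_univ_four, Nat.cast_mul]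
  ring

/-- liveness of unipotent cells is liveness of their line-bundle cells. -/
theorem live_unip_iff (X Y : unipLetters.Cell) : unipAlphabet.Live X Y ↔ MCell.le (UnipLetter.lineCell X) (UnipLetter.lineCell Y) :=
  Iff.rfl

/-! ## §7 The COMPOUND frame of `X = E⁸` and the NON-BOX semi-homogeneous alphabet (block B1)

semihom-2 `SPEC-NONBOX-SEMIHOM-semihom2-g0.md` v1.4 §A–§D (director word «alphabet NON-BOX: OPEN — LIVE ×1» R19.212; idea-crit-hsem-3 memo-h3-05
PASS-WITH-PRICE): `X = E⁸`, coordinates `z₀…z₇`, factor `S_f = (z_{2f}, z_{2f+1})`, `NS(X) ⊗ ℚ = Herm₈(ℚ(i))`; line letters `L_M`, `M ∈ Herm₈(ℤ[i])`; BOX =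
`M` is `2×2`-block-diagonal; `ch(L_M) = exp(c₁) ↔ ch_k = ∧^k M` (compound matrices, entries `det M[I;J]`), `h^k∕k! ↔ Id on ∧^k`, Weil plane
`⟨(I₀;J₀), (J₀;I₀)⟩` with `I₀ = (0,2,4,6)`, `J₀ = (1,3,5,7)`; `μ = Σ ν det M[I₀;J₀]` (the WEIL MINOR; box: `Π_f β_f`); semi-homogeneous `E_δ`:
`ch = r(δ)·exp δ`.  Typed here as a `CellAlphabet` over the word type `XWord = Finset (Fin 8) × Finset (Fin 8)`; the (A1) screen transcribes
literally (`XScreen`); live rule = all principal minors of `Δ` real and `≥ 0` (Sylvester: psd; semihom-2 §D «Hom ≠ 0 iff Δ nef»).  The dictionary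
theorem «`compoundCh (boxMatrix Z)` restricted to block words = `MCell.ch Z`» is semihom-2 §B's calibration (`run-calib.log` 008233714ea57b94), NOT
proved here. -/

/-- a word of the COMPOUND (exterior-algebra) frame of `X = E⁸`: `(I, J)` stands for `dz_I ∧ dz̄_J` (`|I| = |J| = k` ↔ `H^{k,k}`; `|I| ≠ |J|` carries `0`). -/
abbrev XWord : Type := Finset (Fin 8) × Finset (Fin 8)

/-- `I₀ = {0, 2, 4, 6}` (the `z_{2f}` coordinates). -/
def I0 : Finset (Fin 8) := {0, 2, 4, 6}

/-- `J₀ = {1, 3, 5, 7}` (the `z_{2f+1}` coordinates). -/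
def J0 : Finset (Fin 8) := {1, 3, 5, 7}

/-- the Weil word `E = (I₀; J₀)` (its coefficient is `μ`). -/
def eXWord : XWord := (I0, J0)

/-- the conjugate Weil word `E* = (J₀; I₀)` (coefficient `μ̄`). -/
def ebarXWord : XWord := (J0, I0)

/-- the unit word `(∅; ∅)` (coefficient `ch₀` = rank). -/
def oneXWord : XWord := (∅, ∅)

/-- the increasing enumeration of a coordinate set, as the sublist of `0, …, 7` (a `filter`, no sorting — so minors stay `decide`-computable). -/
def enum8 (I : Finset (Fin 8)) : List (Fin 8) := (List.finRange 8).filter (· ∈ I)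

/-- the MINOR `det M[I;J]` (rows `I`, columns `J`, both in increasing order; `0` when `|I| ≠ |J|`). Kernel-computable (`fourier_probe`). -/
def minor (M : Matrix (Fin 8) (Fin 8) R) (I J : Finset (Fin 8)) : R :=
  if h : (enum8 J).length = (enum8 I).length then
    (M.submatrix (fun i : Fin (enum8 I).length => (enum8 I).get i) (fun j => (enum8 J).get (Fin.cast h.symm j))).det
  else 0

/-- the COMPOUND CLASS FUNCTION `(I, J) ↦ r · det M[I;J]` of a slope numerator `M` with rank weight `r` (`ch(E_δ) = r·exp δ`, `ch_k ↔ r·∧^k`). -/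
def compoundCh (r : ℕ) (M : Matrix (Fin 8) (Fin 8) R) : XWord → R := fun IJ => (r : R) * minor M IJ.1 IJ.2

/-- **THE CLASS SCREEN ON THE COMPOUND FRAME** — the literal transcription of (A1) `ch ∈ ℚ[h] ⊕ W` through semihom-2 §B's dictionary
(`h^k∕k! ↔ Id on ∧^k`, `W = ⟨(I₀;J₀), (J₀;I₀)⟩`): (i) every OFF-DIAGONAL entry `(I, J)`, `I ≠ J`, other than the two Weil words vanishes; (ii) DIAGONAL
entries `(I, I)`, `(I′, I′)` of equal size agree (the common value at size `k` is `λ_k`).  semihom-2 LEMMA C1 is what Γ₀-symmetrisation leaves of it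
(16 bidegree rows). -/
def XScreen (T : XWord → R) : Prop :=
  (∀ I J : Finset (Fin 8), I ≠ J → (I, J) ≠ (I0, J0) → (I, J) ≠ (J0, I0) → T (I, J) = 0) ∧
    ∀ I I' : Finset (Fin 8), I.card = I'.card → T (I, I) = T (I', I')

/-- the LIVE rule of the compound frame: all principal minors of `Δ` are real and non-negative (for Hermitian `Δ`: positive semi-definite,
Sylvester; semihom-2 §D: `Hom(L_M, L_{M′} ⊗ P) ≠ 0` for some `P` iff `Δ = M′ − M` is nef). Decidable. -/
abbrev PrincipalMinorsNonneg (Δ : Matrix (Fin 8) (Fin 8) GaussianInt) : Prop :=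
  ∀ I : Finset (Fin 8), (minor Δ I I).im = 0 ∧ 0 ≤ (minor Δ I I).re

/-- **A NON-BOX (semi-homogeneous) LETTER**: a slope numerator `M ∈ Herm₈(ℤ[i])` (slope `δ = M ∕ L` at the reader's scale `L`, cf. `degScale`) and a
rank weight `rk` (semihom-2 §A: «at CLASS level a semi-homogeneous letter is the rational point δ with weight r(δ)»).  Hermitian-ness and box-ness
are predicates (`IsHerm`, `IsBox`), not fields. -/
structure NonboxLetter where
  /-- slope numerator -/
  M : Matrix (Fin 8) (Fin 8) GaussianInt
  /-- rank weight -/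
  rk : ℕ+

namespace NonboxLetter

/-- the numerator is Hermitian. -/
abbrev IsHerm (x : NonboxLetter) : Prop := x.M.conjTranspose = x.M

/-- BOX letter (semihom-2 `is_box`): all entries outside the `2×2` diagonal blocks `(2f, 2f+1)` vanish. -/
abbrev IsBox (x : NonboxLetter) : Prop := ∀ i j : Fin 8, i.val / 2 ≠ j.val / 2 → x.M i j = 0

end NonboxLetter

/-- the `2×2`-block-diagonal matrix of a box cell `Z : MCell` (semihom-2 §B dictionary: block `f` = `[[α_f, β_f], [β̄_f, α_f]]` on `(2f, 2f+1)`;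
`u ↔ ({2f};{2f})`, `v ↔ ({2f+1};{2f+1})`, `e ↔ ({2f};{2f+1})`, `ē ↔ ({2f+1};{2f})`, `p ↔` the block determinant). -/
def boxMatrix (Z : MCell) : Matrix (Fin 8) (Fin 8) GaussianInt :=
  Matrix.of fun i j =>
    if i.val / 2 = j.val / 2 then
      (if i.val % 2 = 0 then (if j.val % 2 = 0 then ((Z (Fin.ofNat 4 (i.val / 2))).1 : GaussianInt) else betaG Z (Fin.ofNat 4 (i.val / 2)))
        else (if j.val % 2 = 0 then star (betaG Z (Fin.ofNat 4 (i.val / 2))) else ((Z (Fin.ofNat 4 (i.val / 2))).1 : GaussianInt)))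
    else 0

/-- a box cell as a non-box letter of rank weight `1`. -/
def NonboxLetter.ofMCell (Z : MCell) : NonboxLetter := ⟨boxMatrix Z, 1⟩

theorem NonboxLetter.isBox_ofMCell (Z : MCell) : (NonboxLetter.ofMCell Z).IsBox := fun i j h => by
  simp [NonboxLetter.ofMCell, boxMatrix, h]

/-- **THE NON-BOX ALPHABET** (cell level, compound frame): cells `NonboxLetter`, `ch = rk · ∧^• M`, `Live X Y` iff `M_Y − M_X` has all principal
minors real `≥ 0`.  SCALE (critic τ1): every letter of ONE design carries its slope NUMERATOR AT ONE COMMON SCALE `L` (slope `= M ∕ L`); `XScreen` is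
homogeneous degree by degree, so the common scale drops out of (H1) and `μ ≠ 0` (cf. `classScreen_degScale_iff`, `degScale_eWord`), but a literal
mixing scales mis-screens silently — don't.  `rk` = Mukai's `r(δ)` is the SPEC's business.  HOM (critic τ2): the field `hom := 0` is a STUB — no
functional of this file reads `hom` on non-box designs (Hall reads `Live` and masses only); no dimension model until semihom-2's U2-K1. -/
abbrev nonboxAlphabet : CellAlphabet GaussianInt XWord :=
  { Cell := NonboxLetter, ch := fun x => compoundCh (x.rk : ℕ) x.M, Live := fun x y => PrincipalMinorsNonneg (y.M - x.M), hom := fun _ _ => 0 }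

namespace MonadDesign

variable {𝔠 : CellAlphabet R XWord} (D : MonadDesign 𝔠)

/-- rank on the compound frame: the `(∅; ∅)` coefficient. -/
def rankX : R := D.wch oneXWord

/-- **μ on the compound frame = the WEIL MINOR** `Σ_N m·rk·det M[I₀;J₀] − Σ_A … − Σ_C …`. -/
def muX : R := D.wch eXWord

/-- `μ̄` on the compound frame. -/
def muBarX : R := D.wch ebarXWord

/-- (H1) on the compound frame. -/
def CleanX : Prop := XScreen D.wch

end MonadDesign

/-- semihom-2 §C's FOURIER block letter `[[2I, F₄], [F₄*, 2I]]` in the `(I₀ | J₀)` decomposition (`F₄ = (i^{jk})_{j,k<4}`), written in the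
coordinates `0…7` (`I₀` = even, `J₀` = odd indices). -/
def fourierLetter : NonboxLetter :=
  ⟨Matrix.of fun i j =>
      if i.val % 2 = 0 ∧ j.val % 2 = 0 then (if i = j then 2 else 0)
      else if i.val % 2 = 1 ∧ j.val % 2 = 1 then (if i = j then 2 else 0)
      else if i.val % 2 = 0 then ⟨0, 1⟩ ^ ((i.val / 2) * (j.val / 2))
      else star ((⟨0, 1⟩ : GaussianInt) ^ ((j.val / 2) * (i.val / 2))),
    1⟩

/-- **KERNEL PROBE reproducing semihom-2 §C**: the Fourier letter is Hermitian, NOT box, and its Weil minor is `μ = det F₄ = −16·i`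
(`run-letters-h4.log`: «Fourier letter [[2I,F₄],[F₄*,2I]]: … μ = −16 i»); its rank coefficient `det M[∅;∅]` is `1`. [`decide`] -/
theorem fourier_probe : fourierLetter.IsHerm ∧ ¬ fourierLetter.IsBox ∧ minor fourierLetter.M I0 J0 = ⟨0, -16⟩ ∧
    minor fourierLetter.M ∅ ∅ = 1 ∧ enum8 I0 = [0, 2, 4, 6] ∧ enum8 J0 = [1, 3, 5, 7] := by
  decide

/-- **DICTIONARY PROBE** (semihom-2 §B «μ(cell) = det M[I₀;J₀] = Π_f β_f»): for the FC cell `[ℓ₁|ℓ₋ᵢ|ℓ₋₁|ℓ_i]` the Weil minor of its block matrix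
is `−1` = the `eeee`-coefficient of `fcCell.ch` (tree `fcCell_coeffs`), its `p`-type principal `2×2` minor `det M[{0,1};{0,1}] = α² − |β|² = 0`,
and its `u`-entry `det M[{0};{0}] = α = 1`. [`decide`] -/
theorem fcCell_dictionary_probe : (NonboxLetter.ofMCell fcCell).IsBox ∧ (NonboxLetter.ofMCell fcCell).IsHerm ∧
    minor (boxMatrix fcCell) I0 J0 = -1 ∧ fcCell.ch eWord = -1 ∧
    minor (boxMatrix fcCell) {0, 1} {0, 1} = 0 ∧ minor (boxMatrix fcCell) {0} {0} = 1 := by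
  refine ⟨NonboxLetter.isBox_ofMCell _, ?_, ?_, fcCell_coeffs.2.2, ?_, ?_⟩ <;> decide

/-- one negative (real part of a) principal minor refutes the psd live rule. -/
theorem not_principalMinorsNonneg_of_neg {Δ : Matrix (Fin 8) (Fin 8) GaussianInt} {I : Finset (Fin 8)} (h : (minor Δ I I).re < 0) :
    ¬ PrincipalMinorsNonneg Δ := fun H => (not_lt.mpr (H I).2) h

/-- **LIVE-RULE DICTIONARY PROBE** (critic τ3; on a `2×2` block `[[a, β], [β̄, a]]` psd ⟺ `a ≥ 0 ∧ a² ≥ |β|²` = `Effective`): the live Koszul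
step `Z = [λ(1,5)|14I³] → Z′ = [λ(1,3)|14I³]` (charge `5 → 3` on the ray `ζ = 1`) is live for `MCell.le`, and `Δ = boxMatrix Z′ − boxMatrix Z` is a
box matrix supported on block `0` with principal minors `det Δ[{0};{0}] = det Δ[{1};{1}] = 2`, `det Δ[{0,1};{0,1}] = 0` (psd, rank 1); the step
`[ℓ₁|ℓ₋ᵢ|ℓ₋₁|ℓ_i] → [O⁴]` (towards the origin, `Δα = −1`) is dead for `MCell.le` AND for the psd rule (`det Δ[{0};{0}] = −1 < 0`,
`not_principalMinorsNonneg_of_neg`).  (The full `2⁸`-minor `decide` of `PrincipalMinorsNonneg` on an `8×8` difference exceeds the kernel budget —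
195 s, aborted — so the live half is certified on the moved block's minors.) [`decide`] -/
theorem live_dictionary_probe :
    (MCell.le (Function.update (apexCell 14) 0 (lineLetter 14 5 0)) (Function.update (apexCell 14) 0 (lineLetter 14 3 0)) ∧
      (NonboxLetter.mk (boxMatrix (Function.update (apexCell 14) 0 (lineLetter 14 3 0)) -
          boxMatrix (Function.update (apexCell 14) 0 (lineLetter 14 5 0))) 1).IsBox ∧
      minor (boxMatrix (Function.update (apexCell 14) 0 (lineLetter 14 3 0)) -
          boxMatrix (Function.update (apexCell 14) 0 (lineLetter 14 5 0))) {0} {0} = 2 ∧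
      minor (boxMatrix (Function.update (apexCell 14) 0 (lineLetter 14 3 0)) -
          boxMatrix (Function.update (apexCell 14) 0 (lineLetter 14 5 0))) {1} {1} = 2 ∧
      minor (boxMatrix (Function.update (apexCell 14) 0 (lineLetter 14 3 0)) -
          boxMatrix (Function.update (apexCell 14) 0 (lineLetter 14 5 0))) {0, 1} {0, 1} = 0) ∧
    (¬ MCell.le fcCell (apexCell 0) ∧ minor (boxMatrix (apexCell 0) - boxMatrix fcCell) {0} {0} = -1 ∧
      ¬ nonboxAlphabet.Live (NonboxLetter.ofMCell fcCell) (NonboxLetter.ofMCell (apexCell 0))) := by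
  refine ⟨⟨by decide, by decide, by decide, by decide, by decide⟩, by decide, by decide, ?_⟩
  exact not_principalMinorsNonneg_of_neg (I := {0}) (by decide)

/-! ## §6 Kernel probes -/

/-- THE SCREEN HAS TEETH in this vocabulary too: the FC cell `[ℓ₁|ℓ₋ᵢ|ℓ₋₁|ℓ_i]` alone, as a kernel presentation with multiplicity `1`, is a
two-term monad design over `bAlph` that is NOT clean (tree `not_classScreen_fcCell`, transported through `wch_ofKernel`∕`wch_ofMConfig`),
while its `μ` is `−1 ≠ 0`. -/
theorem fcCell_monad_not_clean :
    ¬ (MonadDesign.ofKernel (Presentation.ofMConfig ⟨{fcCell}, ∅⟩ (fun _ => 1) fun _ => 1)).Clean ∧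
      (MonadDesign.ofKernel (Presentation.ofMConfig ⟨{fcCell}, ∅⟩ (fun _ => 1) fun _ => 1)).mu = -1 := by
  refine ⟨fun h => not_classScreen_fcCell ?_, ?_⟩
  · rwa [MonadDesign.clean_ofKernel_iff, Presentation.clean_ofMConfig_iff] at h
  · rw [MonadDesign.mu_ofKernel, Presentation.mu, Presentation.wch_ofMConfig]
    simp [MConfig.wch, fcCell_coeffs.2.2]

/-- the KOSZUL-type three-term design on factor `0` at `h = 14`, chain `ζ = 1` (B1PRIME §3(d) ∕ memo-02 B.5: the exact sequence
`0 → λ(ζ,b+4) → λ(ζ,b+2)² → λ(ζ,b) → 0` pulled back from `O(2·0)` on `E`, here `b = 1`, the other three factors at the apex `14I`):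
`A = {[λ(1,5)|14I|14I|14I]}`, `N = {[λ(1,3)|…]}` with multiplicity `2`, `C = {[λ(1,1)|…]}`. -/
def koszulDesign : MonadDesign bAlph :=
  ⟨{Function.update (apexCell 14) 0 (lineLetter 14 5 0)}, {Function.update (apexCell 14) 0 (lineLetter 14 3 0)},
    {Function.update (apexCell 14) 0 (lineLetter 14 1 0)}, fun _ => 1, fun _ => 2, fun _ => 1⟩

set_option synthInstance.maxSize 4096 in -- nested finite quantifiers of `HallJ`
/-- kernel probe: the Koszul design is a genuine three-term design (neither outer term empty), passes joint Hall (both steps live: charge drops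
`5 → 3 → 1` along the ray `ζ = 1`), and — being exact — has class ZERO: `ch(𝓔) = 0`, so count `0` and `μ = 0` (additivity of `wch`). -/
theorem koszul_probe :
    ¬ koszulDesign.IsTwoTerm ∧ koszulDesign.HallJ ∧ koszulDesign.count = 0 ∧ koszulDesign.mu = 0 ∧
      koszulDesign.wch oneWord = 0 ∧ koszulDesign.wch ![1, 0, 0, 0] = 0 ∧ koszulDesign.wch ![5, 1, 1, 0] = 0 := by
  decide +kernel

/-- a band cell that is no line cell: the lowered apex `[(h−2)I]⁴` lies in `BandCell h 2` but not on the LINE `h`. -/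
theorem bandCell_not_lineCell (h : ℤ) : BandCell h 2 (apexCell (h - 2)) ∧ ¬ LineCell h (apexCell (h - 2)) := by
  refine ⟨fun f => ⟨h - 2, by simp, by linarith, 0, 0, rfl⟩, fun hZ => ?_⟩
  obtain ⟨c, k, e⟩ := hZ 0
  rw [apexCell_apply] at e
  simp only [lineLetter, Prod.mk.injEq] at e
  obtain ⟨h1, h2, h3⟩ := e
  have hc : (c : ℤ) = 2 := by linarith
  fin_cases k <;> simp [hc] at h2 h3

end Summit.HodgeConjecture.HodgeConjecture.Cruxes.BlochSeedDiscOne.MonadAlphabet
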